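import Literature.Probability.MarkovChains.LeapfrogIntegrator
import HarnessLib

/-!
# Multiple time-scale (Sexton–Weingarten) molecular-dynamics integrators are reversible and
# area-preserving for every splitting of the force, hence `⟨e^{−δH}⟩ = 1` along their trajectories

Topic `Probability/MarkovChains`; sequel of `LeapfrogIntegrator.lean` (whose maps `drift`, `kick`,
`momFlip`, `leapfrogStep` and theorems `measurePreserving_kick/drift`,
`leapfrogStep_momFlip_leapfrogStep`, `integral_exp_neg_deltaH` are REUSED).  PUBLISHED RESULTS with
our proofs; small definitions with bodies; no named fact is introduced (D-0026).

With dynamical fermions the molecular-dynamics Hamiltonian is `H = ½Σ P² + Σ_{i=0}^k S_i[U]`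
[cite: UrbachEtAl2006, §2.2 eq. (10)] ("for instance with `k = 1` `S_0` might be identified with the
gauge action and `S_1` with the pseudo fermion action"), the force of `S_k` (the pseudofermion
force, one solver call per evaluation) being far more expensive than that of `S_0`.  Sexton and
Weingarten [cite: SextonWeingarten1992] integrate the parts on different time scales; in the notation
of Urbach–Jansen–Shindler–Wenger [cite: UrbachEtAl2006, §2.1–§2.2]:

* eq. (8): `T_U(Δτ) : U → exp(iΔτP)U`, `T_S(Δτ) : P → P − iΔτδS` — the tree's `drift Δτ` and
  `kick F Δτ` (flat phase space, `F = −δS`); eq. (9): `T = T_S(Δτ/2) T_U(Δτ) T_S(Δτ/2)` — the tree's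
  `leapfrogStep`;
* eq. (11): `T_0 = T_{S_0}(Δτ₀/2) T_U(Δτ₀) T_{S_0}(Δτ₀/2)`, eq. (12): `T_{S_i}(Δτ) : P → P − iΔτδS_i`,
  eq. (13): **`T_i = T_{S_i}(Δτ_i/2) [T_{i−1}]^{N_{i−1}} T_{S_i}(Δτ_i/2)`** (`0 < i ≤ k`), "One full
  trajectory `τ` is then composed by `[T_k]^{N_k}`", eq. (14): `Δτ_i = τ/(N_k⋯N_i)` — `nestedLeapfrog`;
* eq. (15): `T_{SW₀} = T_{S_0}(Δτ₀/6) T_U(Δτ₀/2) T_{S_0}(2Δτ₀/3) T_U(Δτ₀/2) T_{S_0}(Δτ₀/6)`, eqs. (16)–(17):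
  **`T_{SW_i} = T_{S_i}(Δτ_i/6) [T_{SW_{i−1}}]^{N_{i−1}} T_{S_i}(2Δτ_i/3) [T_{SW_{i−1}}]^{N_{i−1}} T_{S_i}(Δτ_i/6)`**,
  "usually referred to as the Sexton-Weingarten (SW) integration scheme" — `swIntegrator`;
* THE CLAIM (§2.2, before eq. (11)): "The leap frog integration scheme can be generalized to multiple
  time scales as has been proposed in ref. [Sexton–Weingarten] **without loss of reversibility and
  the area preserving property**."

What is proved (every level `i`, every family of measurable forces `F_i`, step sizes `Δτ_i` and
step numbers `N_i` — no relation among them is needed for these two properties; eq. (14)/(18) only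
fix the trajectory length): `IsReversible T :⇔ T(flip(T x)) = flip x` is enjoyed by drifts, kicks,
palindromes `S ∘ T ∘ S` and iterates of reversible maps (`IsReversible.sandwich`, `.iterate`), so by
`nestedLeapfrog` and `swIntegrator` at every level and by the full trajectories `[T_k]^{N_k}`
(`isReversible_nestedLeapfrog`, `isReversible_swIntegrator`, `…_trajectory`); all of them preserve
phase-space volume (`measurePreserving_nestedLeapfrog`, `measurePreserving_swIntegrator`); hence
`flip ∘ [T_k]^{N_k}` is a volume-preserving involution (the two hypotheses of the HMC exactness
argument, parent file) and `⟨e^{−δH}⟩ = 1` EXACTLY along every multiple time-scale trajectory for ANY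
measurable `H` with finite partition function (`integral_exp_neg_deltaH_nestedLeapfrog`,
`integral_exp_neg_deltaH_swIntegrator`) — in particular the fermion force may sit on the coarsest
level without affecting exactness, only acceptance.  `nestedLeapfrog … 0 = leapfrogStep` (eq. (11) =
eq. (9)).

HONEST SCOPE, as in the parent file: flat phase space `(ι → ℝ) × (ι → ℝ)` with Lebesgue measure; the
gauge-group version of eq. (8) (`exp(iΔτP)U`, Haar measure) is NOT treated — TODO(general form);
nothing about discretization errors (the `O(Δτ²)` cancellations motivating the SW coefficients
`1/6, 2/3, 1/6`), forces, solvers or costs.  Cell pub-lqcd (venture `LatticeQCDFlow`):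
HOME/R2-SCOPE.md §3 E2 route D4 ("exactness = reversible, area-preserving integrator + min(1, e^{−ΔH})
with the exact pseudofermion action") and §4 C-fHMC / the (R)HMC comparator, FANOUT row 38.

## References
* [SextonWeingarten1992] J. C. Sexton, D. H. Weingarten, Hamiltonian evolution for the hybrid Monte
  Carlo algorithm, Nucl. Phys. B 380 (1992) 665 (the multiple time-scale and improved schemes).
* [UrbachEtAl2006] C. Urbach, K. Jansen, A. Shindler, U. Wenger, Comput. Phys. Commun. 174 (2006) 87
  = hep-lat/0506011, §2.1 eqs. (8)–(9), §2.2 eqs. (10)–(18) and the sentence "without loss of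
  reversibility and the area preserving property".
* [MontvayMunster1994] I. Montvay, G. Münster, Quantum Fields on a Lattice, CUP 1994, §7.6.1
  (7.223), (7.233), (7.237)–(7.238) (reversibility, area preservation, `⟨e^{−δH}⟩ = 1`; parent file).
-/

open MeasureTheory

namespace Literature.Probability.MarkovChains.HMC

variable {ι : Type*}

/-! ### Reversibility as a predicate; palindromes and iterates -/

/-- **Reversibility** of a molecular-dynamics map `T` in the form used by the HMC exactness
argument: running `T` from the end point with flipped momenta returns to the start with flipped
momenta, `T(flip(T x)) = flip x` (Montvay–Münster (7.223); "reversible" in Urbach et al. §2.1).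
[cite: MontvayMunster1994, §7.6.1 (7.223)] [cite: UrbachEtAl2006, §2.1 (before eq. (8))] -/
def IsReversible (T : PhaseSpace ι → PhaseSpace ι) : Prop :=
  ∀ x, T (momFlip (T x)) = momFlip x

/-- Unfolding lemma. [cite: MontvayMunster1994, §7.6.1 (7.223)] -/
theorem isReversible_iff (T : PhaseSpace ι → PhaseSpace ι) :
    IsReversible T ↔ ∀ x, T (momFlip (T x)) = momFlip x := Iff.rfl

/-- The identity is reversible. [cite: MontvayMunster1994, §7.6.1 (7.223)] -/
theorem isReversible_id : IsReversible (id : PhaseSpace ι → PhaseSpace ι) :=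
  fun _ => rfl

/-- **A drift `T_U(Δτ)` is reversible**: `φ + Δτπ − Δτπ = φ`. [cite: UrbachEtAl2006, §2.1 eq. (8)] -/
theorem isReversible_drift (dt : ℝ) : IsReversible (drift dt : PhaseSpace ι → PhaseSpace ι) := by
  intro x
  refine Prod.ext ?_ ?_
  · simp only [drift, momFlip, smul_neg]; abel
  · simp only [drift, momFlip]

/-- **A kick `T_S(Δτ)` is reversible** for EVERY force `F` (the force is evaluated at the unchanged
field): `−(π + ΔτF(φ)) + ΔτF(φ) = −π`. [cite: UrbachEtAl2006, §2.1 eq. (8) and §2.2 eq. (12)] -/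
theorem isReversible_kick (F : (ι → ℝ) → (ι → ℝ)) (dt : ℝ) :
    IsReversible (kick F dt : PhaseSpace ι → PhaseSpace ι) := by
  intro x
  refine Prod.ext ?_ ?_
  · simp only [kick, momFlip]
  · simp only [kick, momFlip, neg_add_rev]; abel

/-- **Palindromes of reversible maps are reversible**: `S ∘ T ∘ S` is reversible when `S` and `T` are
(`(STS)flip(STS) = ST(S flip S)TS = S(T flip T)S = S flip S = flip`) — the mechanism behind "without
loss of reversibility" for every symmetric splitting scheme. [cite: UrbachEtAl2006, §2.2 (sentence before eq. (11))] -/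
theorem IsReversible.sandwich {S T : PhaseSpace ι → PhaseSpace ι} (hS : IsReversible S)
    (hT : IsReversible T) : IsReversible (S ∘ T ∘ S) := by
  intro x
  simp only [Function.comp_apply]
  rw [hS, hT, hS]

/-- **Iterates of a reversible map are reversible** (`[T]^N`, the inner loops of eq. (13)/(17) and the
trajectory `[T_k]^{N_k}`). [cite: UrbachEtAl2006, §2.2 eq. (13) ('[T_{i−1}]^{N_{i−1}}', '[T_k]^{N_k}')] -/
theorem IsReversible.iterate {T : PhaseSpace ι → PhaseSpace ι} (hT : IsReversible T) (n : ℕ) :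
    IsReversible T^[n] := by
  induction n with
  | zero => exact isReversible_id
  | succ n ih =>
    intro x
    rw [Function.iterate_succ_apply, Function.iterate_succ_apply', hT, ih]

/-- A reversible map composed with the momentum flip is an involution — the form in which the
Metropolis test on the deterministic proposal `x ↦ flip(T x)` is exact.
[cite: MontvayMunster1994, §7.6.1 (7.223), (7.228)–(7.229)] -/
theorem IsReversible.involutive_momFlip_comp {T : PhaseSpace ι → PhaseSpace ι} (hT : IsReversible T) :
    Function.Involutive (momFlip ∘ T) := by
  intro x
  simp only [Function.comp_apply]
  rw [hT, momFlip_momFlip]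

/-- A reversible map is a bijection of phase space (inverse `flip ∘ T ∘ flip`).
[cite: MontvayMunster1994, §7.6.1 p. 401] -/
theorem IsReversible.bijective {T : PhaseSpace ι → PhaseSpace ι} (hT : IsReversible T) :
    Function.Bijective T := by
  have hl : Function.LeftInverse (momFlip ∘ T ∘ momFlip) T := fun x => by
    simp only [Function.comp_apply]
    rw [hT, momFlip_momFlip]
  refine ⟨hl.injective, fun y => ⟨momFlip (T (momFlip y)), ?_⟩⟩
  have := hT (momFlip y)
  simpa only [momFlip_momFlip] using this

/-- The parent file's one-step leapfrog is reversible in this sense (its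
`leapfrogStep_momFlip_leapfrogStep`). [cite: UrbachEtAl2006, §2.1 eq. (9)] -/
theorem isReversible_leapfrogStep (F : (ι → ℝ) → (ι → ℝ)) (dt : ℝ) :
    IsReversible (leapfrogStep F dt : PhaseSpace ι → PhaseSpace ι) :=
  leapfrogStep_momFlip_leapfrogStep F dt

/-! ### The multiple time-scale leapfrog `T_i` (Urbach et al. eqs. (11)–(13)) -/

/-- **The multiple time-scale leapfrog of Sexton–Weingarten**, recursively over the levels
`i = 0, 1, …`: `T_0 = T_{S_0}(Δτ₀/2) T_U(Δτ₀) T_{S_0}(Δτ₀/2)` and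
`T_i = T_{S_i}(Δτ_i/2) [T_{i−1}]^{N_{i−1}} T_{S_i}(Δτ_i/2)`; `F i` is the force of the part `S_i`
(`F_i = −δS_i`), `dτ i = Δτ_i` its step size, `N i = N_i` the number of inner iterations.  (Eq. (14)
chooses `Δτ_i = τ/(N_k⋯N_i)`; the properties below hold for arbitrary `dτ`.)
[cite: UrbachEtAl2006, §2.2 eqs. (11)–(13)] [cite: SextonWeingarten1992] -/
noncomputable def nestedLeapfrog (F : ℕ → (ι → ℝ) → (ι → ℝ)) (dτ : ℕ → ℝ) (N : ℕ → ℕ) :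
    ℕ → PhaseSpace ι → PhaseSpace ι
  | 0 => kick (F 0) (dτ 0 / 2) ∘ drift (dτ 0) ∘ kick (F 0) (dτ 0 / 2)
  | i + 1 => kick (F (i + 1)) (dτ (i + 1) / 2) ∘ (nestedLeapfrog F dτ N i)^[N i] ∘
      kick (F (i + 1)) (dτ (i + 1) / 2)

/-- Level `0` is the ordinary leapfrog step of the parent file (eq. (11) = eq. (9) for `S_0` alone).
[cite: UrbachEtAl2006, §2.2 eq. (11)] -/
theorem nestedLeapfrog_zero (F : ℕ → (ι → ℝ) → (ι → ℝ)) (dτ : ℕ → ℝ) (N : ℕ → ℕ) :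
    nestedLeapfrog F dτ N 0 = leapfrogStep (F 0) (dτ 0) := rfl

/-- The recursion, eq. (13): `T_{i+1} = T_{S_{i+1}}(Δτ_{i+1}/2) [T_i]^{N_i} T_{S_{i+1}}(Δτ_{i+1}/2)`.
[cite: UrbachEtAl2006, §2.2 eq. (13)] -/
theorem nestedLeapfrog_succ (F : ℕ → (ι → ℝ) → (ι → ℝ)) (dτ : ℕ → ℝ) (N : ℕ → ℕ) (i : ℕ) :
    nestedLeapfrog F dτ N (i + 1) =
      kick (F (i + 1)) (dτ (i + 1) / 2) ∘ (nestedLeapfrog F dτ N i)^[N i] ∘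
        kick (F (i + 1)) (dτ (i + 1) / 2) := rfl

/-- **"without loss of reversibility"**: every level `T_i` of the multiple time-scale leapfrog is
reversible, for all forces, step sizes and iteration numbers.
[cite: UrbachEtAl2006, §2.2 (sentence before eq. (11)) with eq. (13)] [cite: SextonWeingarten1992] -/
theorem isReversible_nestedLeapfrog (F : ℕ → (ι → ℝ) → (ι → ℝ)) (dτ : ℕ → ℝ) (N : ℕ → ℕ) :
    ∀ i, IsReversible (nestedLeapfrog F dτ N i : PhaseSpace ι → PhaseSpace ι)
  | 0 => (isReversible_kick _ _).sandwich (isReversible_drift _)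
  | i + 1 => (isReversible_kick _ _).sandwich ((isReversible_nestedLeapfrog F dτ N i).iterate _)

/-- The full trajectory `[T_k]^{N_k}` is reversible. [cite: UrbachEtAl2006, §2.2 ('One full trajectory τ is then composed by [T_k]^{N_k}')] -/
theorem isReversible_nestedLeapfrog_trajectory (F : ℕ → (ι → ℝ) → (ι → ℝ)) (dτ : ℕ → ℝ)
    (N : ℕ → ℕ) (k : ℕ) :
    IsReversible ((nestedLeapfrog F dτ N k)^[N k] : PhaseSpace ι → PhaseSpace ι) :=
  (isReversible_nestedLeapfrog F dτ N k).iterate _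

/-! ### The Sexton–Weingarten improved scheme `T_{SW_i}` (Urbach et al. eqs. (15)–(17)) -/

/-- **The Sexton–Weingarten integration scheme**, recursively:
`T_{SW₀} = T_{S_0}(Δτ₀/6) T_U(Δτ₀/2) T_{S_0}(2Δτ₀/3) T_U(Δτ₀/2) T_{S_0}(Δτ₀/6)` and
`T_{SW_i} = T_{S_i}(Δτ_i/6) [T_{SW_{i−1}}]^{N_{i−1}} T_{S_i}(2Δτ_i/3) [T_{SW_{i−1}}]^{N_{i−1}} T_{S_i}(Δτ_i/6)`.
(Eq. (18) chooses `Δτ_i = τ/((2N_k)⋯(2N_i))`; the properties below hold for arbitrary `dτ`.)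
[cite: UrbachEtAl2006, §2.2 eqs. (15)–(17)] [cite: SextonWeingarten1992] -/
noncomputable def swIntegrator (F : ℕ → (ι → ℝ) → (ι → ℝ)) (dτ : ℕ → ℝ) (N : ℕ → ℕ) :
    ℕ → PhaseSpace ι → PhaseSpace ι
  | 0 => kick (F 0) (dτ 0 / 6) ∘ (drift (dτ 0 / 2) ∘ kick (F 0) (2 * dτ 0 / 3) ∘ drift (dτ 0 / 2)) ∘
      kick (F 0) (dτ 0 / 6)
  | i + 1 => kick (F (i + 1)) (dτ (i + 1) / 6) ∘
      ((swIntegrator F dτ N i)^[N i] ∘ kick (F (i + 1)) (2 * dτ (i + 1) / 3) ∘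
        (swIntegrator F dτ N i)^[N i]) ∘
      kick (F (i + 1)) (dτ (i + 1) / 6)

/-- Eq. (15), unfolded. [cite: UrbachEtAl2006, §2.2 eq. (15)] -/
theorem swIntegrator_zero (F : ℕ → (ι → ℝ) → (ι → ℝ)) (dτ : ℕ → ℝ) (N : ℕ → ℕ) :
    swIntegrator F dτ N 0 =
      kick (F 0) (dτ 0 / 6) ∘ (drift (dτ 0 / 2) ∘ kick (F 0) (2 * dτ 0 / 3) ∘ drift (dτ 0 / 2)) ∘
        kick (F 0) (dτ 0 / 6) := rfl

/-- Eq. (17), the recursion. [cite: UrbachEtAl2006, §2.2 eqs. (16)–(17)] -/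
theorem swIntegrator_succ (F : ℕ → (ι → ℝ) → (ι → ℝ)) (dτ : ℕ → ℝ) (N : ℕ → ℕ) (i : ℕ) :
    swIntegrator F dτ N (i + 1) =
      kick (F (i + 1)) (dτ (i + 1) / 6) ∘
        ((swIntegrator F dτ N i)^[N i] ∘ kick (F (i + 1)) (2 * dτ (i + 1) / 3) ∘
          (swIntegrator F dτ N i)^[N i]) ∘
        kick (F (i + 1)) (dτ (i + 1) / 6) := rfl

/-- **Every level of the Sexton–Weingarten scheme is reversible** (a palindrome of kicks, drifts and
reversible inner loops). [cite: UrbachEtAl2006, §2.2 (sentence before eq. (11)) with eqs. (15)–(17)]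
[cite: SextonWeingarten1992] -/
theorem isReversible_swIntegrator (F : ℕ → (ι → ℝ) → (ι → ℝ)) (dτ : ℕ → ℝ) (N : ℕ → ℕ) :
    ∀ i, IsReversible (swIntegrator F dτ N i : PhaseSpace ι → PhaseSpace ι)
  | 0 => (isReversible_kick _ _).sandwich ((isReversible_drift _).sandwich (isReversible_kick _ _))
  | i + 1 => (isReversible_kick _ _).sandwich
      (((isReversible_swIntegrator F dτ N i).iterate _).sandwich (isReversible_kick _ _))

/-- The full SW trajectory `[T_{SW_k}]^{N_k}` is reversible. [cite: UrbachEtAl2006, §2.2 eqs. (17)–(18)] -/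
theorem isReversible_swIntegrator_trajectory (F : ℕ → (ι → ℝ) → (ι → ℝ)) (dτ : ℕ → ℝ)
    (N : ℕ → ℕ) (k : ℕ) :
    IsReversible ((swIntegrator F dτ N k)^[N k] : PhaseSpace ι → PhaseSpace ι) :=
  (isReversible_swIntegrator F dτ N k).iterate _

/-! ### Measurability -/

section Measurability

variable {F : ℕ → (ι → ℝ) → (ι → ℝ)}

/-- Every level `T_i` is measurable. [cite: UrbachEtAl2006, §2.2 eq. (13)] -/
theorem measurable_nestedLeapfrog (hF : ∀ i, Measurable (F i)) (dτ : ℕ → ℝ) (N : ℕ → ℕ) :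
    ∀ i, Measurable (nestedLeapfrog F dτ N i : PhaseSpace ι → PhaseSpace ι)
  | 0 => ((measurable_kick (hF 0) _).comp (measurable_drift _)).comp (measurable_kick (hF 0) _)
  | i + 1 => ((measurable_kick (hF _) _).comp
      ((measurable_nestedLeapfrog hF dτ N i).iterate _)).comp (measurable_kick (hF _) _)

/-- Every level `T_{SW_i}` is measurable. [cite: UrbachEtAl2006, §2.2 eq. (17)] -/
theorem measurable_swIntegrator (hF : ∀ i, Measurable (F i)) (dτ : ℕ → ℝ) (N : ℕ → ℕ) :
    ∀ i, Measurable (swIntegrator F dτ N i : PhaseSpace ι → PhaseSpace ι)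
  | 0 => ((measurable_kick (hF 0) _).comp
      (((measurable_drift _).comp (measurable_kick (hF 0) _)).comp (measurable_drift _))).comp
      (measurable_kick (hF 0) _)
  | i + 1 => ((measurable_kick (hF _) _).comp
      ((((measurable_swIntegrator hF dτ N i).iterate _).comp (measurable_kick (hF _) _)).comp
        ((measurable_swIntegrator hF dτ N i).iterate _))).comp (measurable_kick (hF _) _)

end Measurability

/-! ### Area preservation -/

section Volume

variable [Fintype ι] {F : ℕ → (ι → ℝ) → (ι → ℝ)}

/-- **"… and the area preserving property"**: every level `T_i` of the multiple time-scale leapfrog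
preserves phase-space volume (a composition of shears). [cite: UrbachEtAl2006, §2.2 (sentence before eq. (11)) with eq. (13)]
[cite: SextonWeingarten1992] [cite: MontvayMunster1994, §7.6.1 (7.233)] -/
theorem measurePreserving_nestedLeapfrog (hF : ∀ i, Measurable (F i)) (dτ : ℕ → ℝ) (N : ℕ → ℕ) :
    ∀ i, MeasurePreserving (nestedLeapfrog F dτ N i : PhaseSpace ι → PhaseSpace ι) volume volume
  | 0 => ((measurePreserving_kick (hF 0) _).comp (measurePreserving_drift _)).comp
      (measurePreserving_kick (hF 0) _)
  | i + 1 => ((measurePreserving_kick (hF _) _).comp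
      ((measurePreserving_nestedLeapfrog hF dτ N i).iterate _)).comp (measurePreserving_kick (hF _) _)

/-- The trajectory `[T_k]^{N_k}` preserves phase-space volume. [cite: UrbachEtAl2006, §2.2 eq. (13) ('[T_k]^{N_k}')] -/
theorem measurePreserving_nestedLeapfrog_trajectory (hF : ∀ i, Measurable (F i)) (dτ : ℕ → ℝ)
    (N : ℕ → ℕ) (k : ℕ) :
    MeasurePreserving ((nestedLeapfrog F dτ N k)^[N k] : PhaseSpace ι → PhaseSpace ι) volume volume :=
  (measurePreserving_nestedLeapfrog hF dτ N k).iterate _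

/-- **Every level of the Sexton–Weingarten scheme preserves phase-space volume.**
[cite: UrbachEtAl2006, §2.2 (sentence before eq. (11)) with eqs. (15)–(17)] [cite: SextonWeingarten1992] -/
theorem measurePreserving_swIntegrator (hF : ∀ i, Measurable (F i)) (dτ : ℕ → ℝ) (N : ℕ → ℕ) :
    ∀ i, MeasurePreserving (swIntegrator F dτ N i : PhaseSpace ι → PhaseSpace ι) volume volume
  | 0 => ((measurePreserving_kick (hF 0) _).comp
      (((measurePreserving_drift _).comp (measurePreserving_kick (hF 0) _)).comp
        (measurePreserving_drift _))).comp (measurePreserving_kick (hF 0) _)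
  | i + 1 => ((measurePreserving_kick (hF _) _).comp
      ((((measurePreserving_swIntegrator hF dτ N i).iterate _).comp
        (measurePreserving_kick (hF _) _)).comp
        ((measurePreserving_swIntegrator hF dτ N i).iterate _))).comp (measurePreserving_kick (hF _) _)

/-- The SW trajectory `[T_{SW_k}]^{N_k}` preserves phase-space volume. [cite: UrbachEtAl2006, §2.2 eqs. (17)–(18)] -/
theorem measurePreserving_swIntegrator_trajectory (hF : ∀ i, Measurable (F i)) (dτ : ℕ → ℝ)
    (N : ℕ → ℕ) (k : ℕ) :
    MeasurePreserving ((swIntegrator F dτ N k)^[N k] : PhaseSpace ι → PhaseSpace ι) volume volume :=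
  (measurePreserving_swIntegrator hF dτ N k).iterate _

/-- The HMC proposal `flip ∘ [T_k]^{N_k}` built on the multiple time-scale leapfrog is a
volume-preserving involution — the two hypotheses of the exactness argument
(Montvay–Münster (7.226)–(7.229)), for every splitting `S = Σ S_i`.
[cite: UrbachEtAl2006, §2.2 (sentence before eq. (11))] [cite: MontvayMunster1994, §7.6.1 (7.223), (7.229), (7.233)] -/
theorem measurePreserving_involutive_momFlip_nestedLeapfrog (hF : ∀ i, Measurable (F i))
    (dτ : ℕ → ℝ) (N : ℕ → ℕ) (k : ℕ) :
    MeasurePreserving (momFlip ∘ (nestedLeapfrog F dτ N k)^[N k] : PhaseSpace ι → PhaseSpace ι)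
        volume volume ∧
      Function.Involutive (momFlip ∘ (nestedLeapfrog F dτ N k)^[N k] : PhaseSpace ι → PhaseSpace ι) :=
  ⟨measurePreserving_momFlip.comp (measurePreserving_nestedLeapfrog_trajectory hF dτ N k),
    (isReversible_nestedLeapfrog_trajectory F dτ N k).involutive_momFlip_comp⟩

/-- The same for the Sexton–Weingarten scheme. [cite: UrbachEtAl2006, §2.2 eqs. (15)–(17)]
[cite: MontvayMunster1994, §7.6.1 (7.223), (7.229), (7.233)] -/
theorem measurePreserving_involutive_momFlip_swIntegrator (hF : ∀ i, Measurable (F i))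
    (dτ : ℕ → ℝ) (N : ℕ → ℕ) (k : ℕ) :
    MeasurePreserving (momFlip ∘ (swIntegrator F dτ N k)^[N k] : PhaseSpace ι → PhaseSpace ι)
        volume volume ∧
      Function.Involutive (momFlip ∘ (swIntegrator F dτ N k)^[N k] : PhaseSpace ι → PhaseSpace ι) :=
  ⟨measurePreserving_momFlip.comp (measurePreserving_swIntegrator_trajectory hF dτ N k),
    (isReversible_swIntegrator_trajectory F dτ N k).involutive_momFlip_comp⟩

end Volume

/-! ### Consequence: `⟨e^{−δH}⟩ = 1` along multiple time-scale trajectories -/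

section ExpDeltaH

variable [Fintype ι] {F : ℕ → (ι → ℝ) → (ι → ℝ)} {H : PhaseSpace ι → ℝ}

/-- **`⟨e^{−δH}⟩ = 1` exactly for multiple time-scale leapfrog HMC** — any measurable forces `F_i` on
any levels (the pseudofermion force may sit on the coarsest one), any step sizes and iteration
numbers, any measurable `H` with `0 < Z = ∫e^{−H} < ∞`. [cite: MontvayMunster1994, §7.6.1 (7.237)–(7.238)]
[cite: UrbachEtAl2006, §2.2 (sentence before eq. (11))] -/
theorem integral_exp_neg_deltaH_nestedLeapfrog (hF : ∀ i, Measurable (F i)) (hH : Measurable H)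
    (hZ : 0 < partitionFn volume H) (dτ : ℕ → ℝ) (N : ℕ → ℕ) (k : ℕ) :
    ∫ x, Real.exp (-(H ((nestedLeapfrog F dτ N k)^[N k] x) - H x)) ∂(boltzmann volume H) = 1 :=
  integral_exp_neg_deltaH (measurePreserving_nestedLeapfrog_trajectory hF dτ N k) hH hZ

/-- **`⟨e^{−δH}⟩ = 1` exactly along Sexton–Weingarten trajectories.**
[cite: MontvayMunster1994, §7.6.1 (7.237)–(7.238)] [cite: UrbachEtAl2006, §2.2 eqs. (15)–(17)]
[cite: SextonWeingarten1992] -/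
theorem integral_exp_neg_deltaH_swIntegrator (hF : ∀ i, Measurable (F i)) (hH : Measurable H)
    (hZ : 0 < partitionFn volume H) (dτ : ℕ → ℝ) (N : ℕ → ℕ) (k : ℕ) :
    ∫ x, Real.exp (-(H ((swIntegrator F dτ N k)^[N k] x) - H x)) ∂(boltzmann volume H) = 1 :=
  integral_exp_neg_deltaH (measurePreserving_swIntegrator_trajectory hF dτ N k) hH hZ

/-- `⟨δH⟩ ≥ 0` along multiple time-scale trajectories (Jensen). [cite: MontvayMunster1994, §7.6.1 (7.238)] -/
theorem integral_deltaH_nonneg_nestedLeapfrog (hF : ∀ i, Measurable (F i)) (hH : Measurable H)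
    (hint : Integrable (fun x => Real.exp (-H x)) volume) (hZ : 0 < partitionFn volume H)
    {dτ : ℕ → ℝ} {N : ℕ → ℕ} {k : ℕ}
    (hδ : Integrable (fun x => H ((nestedLeapfrog F dτ N k)^[N k] x) - H x) (boltzmann volume H)) :
    0 ≤ ∫ x, (H ((nestedLeapfrog F dτ N k)^[N k] x) - H x) ∂(boltzmann volume H) :=
  integral_deltaH_nonneg (measurePreserving_nestedLeapfrog_trajectory hF dτ N k) hH hint hZ hδ

end ExpDeltaH

end Literature.Probability.MarkovChains.HMC
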